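import Literature.MathematicalPhysics.QuantumFieldTheory.QuasiLocalGaugePerturbationCells
import Literature.MathematicalPhysics.QuantumFieldTheory.BlockCellGeometry
import Literature.Probability.LatticeModels.CoarseCellMixingCounting
import HarnessLib

/-!
# Quasi-local gauge-invariant perturbations, VII: one-boundary-cell influence of the DLR kernels;
cube-diagonal parts are free

Seventh file on the tree's `QuasiLocalGaugePerturbation d N G c` (after `…Kernels`, `…Locality`,
`…Cells`). The DLR kernels `(D + O).kernel ρ β` (`…Cells`: glued product Haar tilted by
`-β S_W - (D + O)`) of the block-scale perturbed torus measure `μ_{β, D+O}`, with `D`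
CUBE-DIAGONAL (activities on single blocks of scale `c` only — an arbitrary bounded
self-interaction of each cube, NOT small) and `O` Kotecký–Preiss small with range control, are
read through the cells of the explicit product frame `prodFrame N (2c) μ` of scale `2c`
(`BlockCellGeometry`, `ZModTorusFrames`; `(μ+1)·2c ≤ N < (μ+2)·2c`). Output: the comparison of
the single-cell kernels `γ_{Λ_x}(· | ω)`, `γ_{Λ_x}(· | ζ)`, `Λ_x = {e | cellOf e = x}`, for two
exteriors differing on ONE cell `y` — the entries of Dobrushin's interdependence matrix for the
system of cells (Georgii 2011, (8.5) and Remark 8.26), in ratio form — which do not see `D` at all.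

## Main results (theorems only: no definition, no named fact)

* `siteCell_prodFrame_blockCorner` — *blocks lie inside cells*: `⌊c⌊v/c⌋/(2c)⌋ = ⌊v/(2c)⌋`, a
  site and its block corner carry the same cell label (`cellOf_prodFrame_eq_siteCell_blockCorner`).
* `QuasiLocalGaugePerturbation.cubeDiagonal_total_glueWith_sub_eq` — *cube-diagonal perturbations
  are free*: on the region `Λ_x` of links of one cell, the difference `D(uω) - D(uζ)` of the totals
  of a cube-diagonal `D` glued with two ARBITRARY exteriors does not depend on the glued variables
  `u` (the links of a block are all in `Λ_x` or all outside).
* `QuasiLocalGaugePerturbation.kernel_eq_kernel_zero_add_smul_wilson` — *coupling shift*: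
  `-β S_W - (D+O) = -(D + O')`, `O' = O + β • wilson` (`total_wilson`), so
  `(D+O).kernel ρ β = (D+O').kernel ρ 0`; `O'` is KP-small (`normLE_add_smul_wilson`:
  `‖O'‖_{c,κ} ≤ η + |β| C_W`, `normLE_smul_wilson`) and range controlled
  (`rangeControl_add_smul_wilson`: plaquette supports are `1`-short, `plaquetteSupport_short`).
* `QuasiLocalGaugePerturbation.integral_kernel_cell_le_exp_mul` — **the one-boundary-cell
  comparison**: for exteriors `ω = ζ` off the cell `y` and a `[0,1]`-valued measurable `g` reading
  only cell `x`, `γ_{Λ_x}(g | ω) ≤ e^{2a} γ_{Λ_x}(g | ζ)` for the kernels of `μ_{0, D+O'}` and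
  every `a ≥ 2 η' 10^d e^{-κ(2·cdist y x - 2)}`: two tilts of one glued product Haar measure
  (`integral_glued_tilted_le_exp_mul`) by energies whose difference in `u` is the constant `D`-part
  plus an `O'`-part within `a` of a constant — `exists_abs_total_glueWith_sub_le` twice for
  `cdist y x ≤ 1` (a cell meets `≤ 10^d` blocks, `card_image_blockCorner_le_mul_cellCount`),
  `exists_abs_total_glueWith_sub_sub_le` with `m = 2(cdist y x - 2)` otherwise, the far links
  being off cell `y` because labels contract block nearness (`cdist_cellOf_le_of_blockCorner_near`).

## References

* H.-O. Georgii, *Gibbs Measures and Phase Transitions*, 2nd ed. (de Gruyter 2011), Ch. 8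
  (bounded perturbations of specifications; Dobrushin's interdependence matrix (8.5), Remark 8.26).
  [Georgii2011]
* T. Bałaban, CMP 119 (1988) 243–285, p. 261 (2.42) (exponential decay of localized terms in the
  weighted-norm format). [Balaban1988Convergent]
-/

noncomputable section

open MeasureTheory
open Literature.Probability.LatticeModels (CoarseIdx cdist cdist_comm cellCount glueWith
  glueWith_apply_mem glueWith_apply_not_mem integral_glued_tilted_le_exp_mul frameLabel axisFrame)
open Literature.MathematicalPhysics.QuantumLattice

namespace Literature.MathematicalPhysics.QuantumFieldTheory

/-! ### Geometry: blocks of scale `c` lie inside the cells of the product frame of scale `2c` -/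

section Geometry

variable {d N : ℕ} [NeZero N] {c : ℕ}

/-- Blocks of scale `c` lie inside the cells of the product frame of scale `2c`: the block corner
of a site has the same cell label (`⌊(c⌊v/c⌋)/(2c)⌋ = ⌊v/(2c)⌋`). [folklore] -/
theorem siteCell_prodFrame_blockCorner (hc : 0 < c) (μ : ℕ) (x : Site d N) :
    siteCell (prodFrame N (2 * c) μ) (blockCorner c x) = siteCell (prodFrame N (2 * c) μ) x := by
  funext i
  simp only [siteCell, prodFrame, axisFrame]
  rw [val_blockCorner]
  congr 1
  unfold frameLabel
  congr 1
  rw [mul_comm 2 c, ← Nat.div_div_eq_div_mul, ← Nat.div_div_eq_div_mul, Nat.mul_div_cancel _ hc]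

/-- The cell of a link is the cell of the corner of its block. [folklore] -/
theorem cellOf_prodFrame_eq_siteCell_blockCorner (hc : 0 < c) (μ : ℕ) (e : Edge d N) :
    cellOf (prodFrame N (2 * c) μ) e = siteCell (prodFrame N (2 * c) μ) (blockCorner c e.1) :=
  (siteCell_prodFrame_blockCorner hc μ e.1).symm

end Geometry

namespace QuasiLocalGaugePerturbation

/-! ### The cube-diagonal part does not see the glued variables -/

section Diagonal

variable {d N : ℕ} [NeZero N] {G : Type*} [Group G] [MeasurableSpace G] {c : ℕ}

/-- **Cube-diagonal perturbations are free.** For a cube-diagonal `D` (activities on single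
blocks only) and the region `Λ` of links of ONE cell of the product frame of scale `2c`, the
difference `D(u ω) - D(u ζ)` of the totals on the configurations glued with two ARBITRARY
exteriors does not depend on the glued variables `u`: the links of a block `{z}` are all in `Λ`
(cell of `z` is the cell of `Λ`; then both exteriors give the same value) or all outside `Λ`
(then neither term sees `u`). [folklore] -/
theorem cubeDiagonal_total_glueWith_sub_eq (hc : 0 < c) (μ : ℕ)
    (D : QuasiLocalGaugePerturbation d N G c)
    (hD : ∀ X : Finset (Site d N), X.card ≠ 1 → ∀ V : GaugeConfig d N G, D.act X V = 0)
    (x : CoarseIdx (fun _ : Fin d => μ)) {Λ : Finset (Edge d N)}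
    (hΛ : ∀ e, e ∈ Λ ↔ cellOf (prodFrame N (2 * c) μ) e = x) (ω ζ : GaugeConfig d N G)
    (u u₀ : ↥Λ → G) :
    D.total (glueWith Λ u ω) - D.total (glueWith Λ u ζ) =
      D.total (glueWith Λ u₀ ω) - D.total (glueWith Λ u₀ ζ) := by
  simp only [QuasiLocalGaugePerturbation.total, ← Finset.sum_sub_distrib]
  refine Finset.sum_congr rfl fun X _ => ?_
  by_cases h1 : X.card = 1
  · obtain ⟨z, rfl⟩ := Finset.card_eq_one.1 h1
    by_cases hz : siteCell (prodFrame N (2 * c) μ) z = x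
    · have hin : ∀ v : ↥Λ → G,
          D.act {z} (glueWith Λ v ω) = D.act {z} (glueWith Λ v ζ) := fun v => by
        refine D.dependsOn {z} fun e he => ?_
        have hez : blockCorner c e.1 = z :=
          Finset.mem_singleton.1 (mem_polymerEdges_iff.1 (Finset.mem_coe.1 he))
        have heΛ : e ∈ Λ :=
          (hΛ e).2 (by rw [cellOf_prodFrame_eq_siteCell_blockCorner hc, hez, hz])
        rw [glueWith_apply_mem _ _ _ heΛ, glueWith_apply_mem _ _ _ heΛ]
      rw [hin u, hin u₀, sub_self, sub_self]
    · have hXΛ : ∀ e ∈ Λ, blockCorner c e.1 ∉ ({z} : Finset (Site d N)) := fun e he hez => by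
        rw [Finset.mem_singleton] at hez
        have hex := (hΛ e).1 he
        rw [cellOf_prodFrame_eq_siteCell_blockCorner hc, hez] at hex
        exact hz hex
      rw [apply_glueWith_eq_of_forall_not_mem hXΛ (D.dependsOn {z}) ω u u₀,
        apply_glueWith_eq_of_forall_not_mem hXΛ (D.dependsOn {z}) ζ u u₀]
  · simp only [hD X h1, sub_self]

end Diagonal

/-! ### The coupling shift `-β S_W - (D + O) = -(D + (O + β • wilson))` -/

section Shift

variable {d N : ℕ} [NeZero N] {G : Type*} [Group G] [TopologicalSpace G] [IsTopologicalGroup G]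
  [CompactSpace G] [MeasurableSpace G] [BorelSpace G] [SecondCountableTopology G] {Nρ : ℕ}
  (ρ : G →* Matrix (Fin Nρ) (Fin Nρ) ℂ) (hρ : Continuous ρ) {c : ℕ}

/-- The full action `-β S_W - (D+O)` is the pure perturbation `-(D + (O + β • wilson))` at
coupling `0` (`total_wilson`). [folklore] -/
theorem action_eq_action_zero_add_smul_wilson (β : ℝ) (D O : QuasiLocalGaugePerturbation d N G c) :
    (fun U : GaugeConfig d N G => -β * wilsonAction ρ U - (D + O).total U) =
      fun U => -(0 : ℝ) * wilsonAction ρ U -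
        (D + (O + β • QuasiLocalGaugePerturbation.wilson ρ hρ c)).total U := by
  funext U
  simp only [QuasiLocalGaugePerturbation.total_add, QuasiLocalGaugePerturbation.total_smul,
    QuasiLocalGaugePerturbation.total_wilson, Pi.add_apply, Pi.smul_apply, smul_eq_mul]
  ring

/-- **Coupling shift for the kernels**: `(D + O).kernel ρ β = (D + (O + β • wilson)).kernel ρ 0`.
[folklore] -/
theorem kernel_eq_kernel_zero_add_smul_wilson (β : ℝ) (D O : QuasiLocalGaugePerturbation d N G c) :
    (D + O).kernel ρ β = (D + (O + β • QuasiLocalGaugePerturbation.wilson ρ hρ c)).kernel ρ 0 := by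
  funext Λ ζ
  simp only [QuasiLocalGaugePerturbation.kernel]
  rw [action_eq_action_zero_add_smul_wilson ρ hρ β D O]

/-- The shifted perturbation `O + β • wilson` is KP-small: `‖O'‖_{c,κ} ≤ η + |β| C_W`
(`normLE_smul_wilson`, unitary `ρ`, `κ ≥ 0`, `c ≥ 1`). [folklore] -/
theorem normLE_add_smul_wilson (hρu : ∀ g, ρ g ∈ Matrix.unitaryGroup (Fin Nρ) ℂ) {κ η : ℝ}
    (hκ : 0 ≤ κ) (hc : 0 < c) (O : QuasiLocalGaugePerturbation d N G c) (hO : O.NormLE κ η)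
    (β : ℝ) :
    (O + β • QuasiLocalGaugePerturbation.wilson ρ hρ c).NormLE κ
      (η + |β| * (2 * Nρ * Real.exp (3 * κ) * (3 * d ^ 2 * c ^ d : ℕ))) :=
  hO.add (QuasiLocalGaugePerturbation.normLE_smul_wilson ρ hρ hρu hκ hc β)

/-- The shifted perturbation `O + β • wilson` has range control if `O` has: a plaquette support
is `1`-short (`plaquetteSupport_short`). [folklore] -/
theorem rangeControl_add_smul_wilson (hc : 0 < c) (O : QuasiLocalGaugePerturbation d N G c)
    (hRC : ∀ X : Finset (Site d N), X ∈ polymers c → (∃ U : GaugeConfig d N G, O.act X U ≠ 0) →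
      ∀ y ∈ X, ∀ y' ∈ X, ∀ i : Fin d, (y i - y' i).val ≤ c * X.card ∨ (y' i - y i).val ≤ c * X.card)
    (β : ℝ) :
    ∀ X : Finset (Site d N), X ∈ polymers c →
      (∃ U : GaugeConfig d N G, (O + β • QuasiLocalGaugePerturbation.wilson ρ hρ c).act X U ≠ 0) →
      ∀ y ∈ X, ∀ y' ∈ X, ∀ i : Fin d,
        (y i - y' i).val ≤ c * X.card ∨ (y' i - y i).val ≤ c * X.card := by
  rintro X hX ⟨U, hU⟩ y hy y' hy' i
  by_cases hO0 : O.act X U = 0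
  · rw [QuasiLocalGaugePerturbation.add_act, QuasiLocalGaugePerturbation.smul_act, hO0,
      zero_add] at hU
    have hw : (QuasiLocalGaugePerturbation.wilson ρ hρ c).act X U ≠ 0 := fun h => hU (by
      rw [h, mul_zero])
    rw [QuasiLocalGaugePerturbation.wilson_act] at hw
    obtain ⟨p, hp, -⟩ := Finset.exists_ne_zero_of_sum_ne_zero hw
    have hpX : plaquetteSupport c p = X := (Finset.mem_filter.1 hp).2
    subst hpX
    have h1 : c * 1 ≤ c * (plaquetteSupport c p).card :=
      Nat.mul_le_mul_left c (Finset.card_pos.2 ⟨y, hy⟩)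
    exact (plaquetteSupport_short hc le_rfl p y hy y' hy' i).imp (fun h => h.trans h1)
      (fun h => h.trans h1)
  · exact hRC X hX ⟨U, hO0⟩ y hy y' hy' i

end Shift

/-! ### The one-boundary-cell comparison of the single-cell kernels -/

section Comparison

variable {d N : ℕ} [NeZero N] {G : Type*} [Group G] [TopologicalSpace G] [IsTopologicalGroup G]
  [CompactSpace G] [MeasurableSpace G] [BorelSpace G] [SecondCountableTopology G] {Nρ : ℕ}
  (ρ : G →* Matrix (Fin Nρ) (Fin Nρ) ℂ) (hρ : Continuous ρ) {c μ : ℕ}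

include hρ in
/-- **One-boundary-cell comparison of the single-cell kernels of `μ_{0, D + O'}`.** On the torus
framed by `prodFrame N (2c) μ` (`(μ+1)·2c ≤ N < (μ+2)·2c`), for a cube-diagonal `D`, a KP-small
range-controlled `O'` (`‖O'‖_{c,κ} ≤ η'`, `κ ≥ 0`), two exteriors `ω = ζ` off the cell `y` and a
`[0,1]`-valued measurable `g` reading only the cell `x`, the kernel expectations on
`Λ_x = {e | cellOf e = x}` compare within `e^{2a}` for every
`a ≥ 2 η' 10^d e^{-κ (2·cdist y x - 2)}`: the two kernels are tilts of one glued product Haar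
measure by energies whose difference in the glued variables is the `u`-constant `D`-part
(`cubeDiagonal_total_glueWith_sub_eq`) plus an `O'`-part within `a` of a constant
(`exists_abs_total_glueWith_sub_le` for `cdist y x ≤ 1`; `exists_abs_total_glueWith_sub_sub_le`
with `m = 2(cdist y x - 2)` otherwise, the far links being off cell `y` by
`cdist_cellOf_le_of_blockCorner_near`; a cell meets `≤ 10^d` blocks).
[cite: Georgii2011, Ch. 8] -/
theorem integral_kernel_cell_le_exp_mul (hc : 0 < c) (h1 : μ * (2 * c) + 2 * c ≤ N)
    (h2 : N < μ * (2 * c) + 2 * (2 * c)) (D O' : QuasiLocalGaugePerturbation d N G c)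
    (hD : ∀ X : Finset (Site d N), X.card ≠ 1 → ∀ V : GaugeConfig d N G, D.act X V = 0)
    {κ η' : ℝ} (hκ : 0 ≤ κ) (hO' : O'.NormLE κ η')
    (hRC' : ∀ X : Finset (Site d N), X ∈ polymers c → (∃ U : GaugeConfig d N G, O'.act X U ≠ 0) →
      ∀ y ∈ X, ∀ y' ∈ X, ∀ i : Fin d, (y i - y' i).val ≤ c * X.card ∨ (y' i - y i).val ≤ c * X.card)
    (x y : CoarseIdx (fun _ : Fin d => μ)) {ω ζ : GaugeConfig d N G}
    (hωζ : ∀ e, cellOf (prodFrame N (2 * c) μ) e ≠ y → ω e = ζ e) {a : ℝ}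
    (ha : 2 * η' * (10 : ℝ) ^ d * Real.exp (-(κ * (2 * (cdist y x : ℝ) - 2))) ≤ a)
    {g : GaugeConfig d N G → ℝ} (hg : Measurable g) (hg01 : ∀ U, 0 ≤ g U ∧ g U ≤ 1)
    (hdep : DependsOn g {e | cellOf (prodFrame N (2 * c) μ) e = x}) :
    ∫ U, g U ∂((D + O').kernel ρ 0
        (Finset.univ.filter fun e => cellOf (prodFrame N (2 * c) μ) e = x) ω) ≤
      Real.exp (2 * a) * ∫ U, g U ∂((D + O').kernel ρ 0
        (Finset.univ.filter fun e => cellOf (prodFrame N (2 * c) μ) e = x) ζ) := by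
  classical
  set Λ := Finset.univ.filter fun e => cellOf (prodFrame N (2 * c) μ) e = x with hΛdef
  have hmemΛ : ∀ e, e ∈ Λ ↔ cellOf (prodFrame N (2 * c) μ) e = x := fun e => by
    simp [hΛdef]
  set R := Λ.image fun e => blockCorner c e.1 with hRdef
  have hR : R ⊆ blockCorners c := fun z hz => by
    obtain ⟨e, -, rfl⟩ := Finset.mem_image.1 hz
    exact mem_blockCorners_iff.2 (isBlockAligned_blockCorner c e.1)
  have hΛR : ∀ e ∈ Λ, blockCorner c e.1 ∈ R := fun e he => Finset.mem_image_of_mem _ he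
  -- a cell meets at most `10^d` blocks
  have hRcard : (R.card : ℝ) ≤ 10 ^ d := by
    have h := card_image_blockCorner_le_mul_cellCount hc (by omega : 0 < 2 * c)
      (by omega : 2 * c ≤ 4 * c) h2 Λ
    have hcc : cellCount (cellOf (prodFrame N (2 * c) μ)) Λ ≤ 1 := by
      unfold cellCount
      refine (Finset.card_le_card (t := {x}) fun c' hc' => ?_).trans (Finset.card_singleton x).le
      obtain ⟨-, v, hv, rfl⟩ := Finset.mem_filter.1 hc'
      exact Finset.mem_singleton.2 ((hmemΛ v).1 hv)
    have h' : R.card ≤ 10 ^ d :=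
      h.trans ((Nat.mul_le_mul_left _ hcc).trans (mul_one _).le)
    exact_mod_cast h'
  have hη' : 0 ≤ η' := hO'.nonneg
  -- the `O'`-part is within `a` of a constant in the glued variables
  obtain ⟨cO, hcO⟩ : ∃ cO : ℝ, ∀ u : ↥Λ → G,
      |O'.total (glueWith Λ u ω) - O'.total (glueWith Λ u ζ) - cO| ≤ a := by
    by_cases hd : cdist y x ≤ 1
    · obtain ⟨c₁, hc₁⟩ := O'.exists_abs_total_glueWith_sub_le hκ hO' hR hΛR ω
      obtain ⟨c₂, hc₂⟩ := O'.exists_abs_total_glueWith_sub_le hκ hO' hR hΛR ζ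
      refine ⟨c₁ - c₂, fun u => ?_⟩
      have hexp : 1 ≤ Real.exp (-(κ * (2 * (cdist y x : ℝ) - 2))) :=
        Real.one_le_exp (by
          have : (cdist y x : ℝ) ≤ 1 := by exact_mod_cast hd
          nlinarith)
      calc |O'.total (glueWith Λ u ω) - O'.total (glueWith Λ u ζ) - (c₁ - c₂)|
          = |(O'.total (glueWith Λ u ω) - c₁) - (O'.total (glueWith Λ u ζ) - c₂)| := by ring_nf
        _ ≤ |O'.total (glueWith Λ u ω) - c₁| + |O'.total (glueWith Λ u ζ) - c₂| := abs_sub _ _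
        _ ≤ η' * R.card + η' * R.card := add_le_add (hc₁ u) (hc₂ u)
        _ = 2 * η' * R.card * 1 := by ring
        _ ≤ 2 * η' * (10 : ℝ) ^ d * Real.exp (-(κ * (2 * (cdist y x : ℝ) - 2))) :=
            mul_le_mul (mul_le_mul_of_nonneg_left hRcard (by positivity)) hexp zero_le_one
              (by positivity)
        _ ≤ a := ha
    · push Not at hd
      obtain ⟨D', hD'⟩ : ∃ D' : ℕ, cdist y x = D' + 2 := ⟨cdist y x - 2, by omega⟩
      have hζ' : ∀ e : Edge d N, (∃ y₀ ∈ R, ∀ i,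
          (y₀ i - blockCorner c e.1 i).val ≤ c * (2 * D' + 1) ∨
            (blockCorner c e.1 i - y₀ i).val ≤ c * (2 * D' + 1)) → ω e = ζ e := by
        rintro e ⟨y₀, hy₀, hnear⟩
        obtain ⟨e', he', rfl⟩ := Finset.mem_image.1 hy₀
        refine hωζ e fun hey => ?_
        have hle := cdist_cellOf_le_of_blockCorner_near (Nat.one_le_iff_ne_zero.2 hc.ne')
          (by omega : 0 < 2 * c) le_rfl h1 D' e e' hnear
        rw [(hmemΛ e').1 he', hey, cdist_comm] at hle
        omega
      obtain ⟨cO, hcO⟩ :=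
        O'.exists_abs_total_glueWith_sub_sub_le hκ hO' hRC' hR hΛR (2 * D') hζ'
      refine ⟨cO, fun u => (hcO u).trans ?_⟩
      have hcast : ((2 * D' : ℕ) : ℝ) + 2 = 2 * (cdist y x : ℝ) - 2 := by
        rw [hD']; push_cast; ring
      rw [hcast]
      calc 2 * (η' * Real.exp (-(κ * (2 * (cdist y x : ℝ) - 2)))) * R.card
          ≤ 2 * (η' * Real.exp (-(κ * (2 * (cdist y x : ℝ) - 2)))) * (10 : ℝ) ^ d :=
            mul_le_mul_of_nonneg_left hRcard (by positivity)
        _ = 2 * η' * (10 : ℝ) ^ d * Real.exp (-(κ * (2 * (cdist y x : ℝ) - 2))) := by ring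
        _ ≤ a := ha
  -- the observable does not distinguish the two glued configurations
  have hgζ : ∀ u : ↥Λ → G, g (glueWith Λ u ω) = g (glueWith Λ u ζ) := fun u =>
    hdep fun e he => by
      have heΛ : e ∈ Λ := (hmemΛ e).2 he
      rw [glueWith_apply_mem _ _ _ heΛ, glueWith_apply_mem _ _ _ heΛ]
  let u₀ : ↥Λ → G := fun _ => 1
  exact integral_glued_tilted_le_exp_mul (haarProbability G) Λ ω ζ
    (QuasiLocalGaugePerturbation.measurable_action ρ hρ 0 (D + O'))
    (QuasiLocalGaugePerturbation.measurable_action ρ hρ 0 (D + O'))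
    (QuasiLocalGaugePerturbation.exists_abs_action_le ρ hρ 0 (D + O'))
    (QuasiLocalGaugePerturbation.exists_abs_action_le ρ hρ 0 (D + O')) hg hg01 hgζ
    (c := -(D.total (glueWith Λ u₀ ω) - D.total (glueWith Λ u₀ ζ)) - cO) (ε := a) fun u => by
      have hDu := cubeDiagonal_total_glueWith_sub_eq hc μ D hD x hmemΛ ω ζ u u₀
      have hrw : (-(0 : ℝ) * wilsonAction ρ (glueWith Λ u ω) - (D + O').total (glueWith Λ u ω)) -
          (-(0 : ℝ) * wilsonAction ρ (glueWith Λ u ζ) - (D + O').total (glueWith Λ u ζ)) -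
          (-(D.total (glueWith Λ u₀ ω) - D.total (glueWith Λ u₀ ζ)) - cO) =
          -(O'.total (glueWith Λ u ω) - O'.total (glueWith Λ u ζ) - cO) := by
        rw [← hDu]
        simp only [QuasiLocalGaugePerturbation.total_add, Pi.add_apply]
        ring
      rw [hrw, abs_neg]
      exact hcO u

end Comparison

end QuasiLocalGaugePerturbation

end Literature.MathematicalPhysics.QuantumFieldTheory

end
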